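import Mathlib
import Literature.NumberTheory.NumberFields.PureCubicClassNumberModThreeProofs
import HarnessLib

/-!
# Genus theory for pure cubic fields with a general radicand — lemmas

Topic `NumberTheory/NumberFields`.  Theorem-only file (no definition, no named fact, D-0026),
unconditional; the elementary layer of `PureCubicGenusDivisor.lean`, which extends Installment 2 of
`PureCubicClassNumberModThreeProofs.lean` (`Honda1971.three_dvd_classNumber_of_prime_mod_three`,
radicand `m = pq`) to an ARBITRARY natural radicand `m` and a prime `ℓ ≡ 1 (mod 3)` with
`3 ∤ v_ℓ(m)` (e.g. `ℓ ∥ m`) — exactly the condition for `ℓ` to be totally ramified in `ℚ(∛m)`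
(T. Honda, J. Number Theory 3 (1971) 7–12, §1; M. Ishida, LNM 555 (1976), Ch. 7 eq. (7.7)).

* `Honda1971.pow_three_ne_of_not_dvd_padicValNat`, `Honda1971.irreducible_X_pow_three_sub_natCast`,
  `Honda1971.minpoly_eq_of_not_dvd_padicValNat`, `Honda1971.adjoin_eq_top_of_not_dvd_padicValNat` —
  `m` with `3 ∤ v_ℓ(m)` is not a rational cube, `X³ − m` is irreducible over `ℚ`, and a cubic number
  field `K ∋ α`, `α³ = m`, is `ℚ(α)` with `minpoly α = X³ − m`;
* `Honda1971.ramificationIdx_eq_three_of_not_dvd_padicValNat` — `ℓ` is totally ramified in such a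
  `K` (`3 v(∛m) = v_ℓ(m) e(v|ℓ)` and `e ≤ 3`);
* `Honda1971.pow_three_ne_natCast_of_isGalois` — the one ingredient not needed for `m = pq`:
  `X³ − m` has NO root in a Galois cubic number field (it would split there, and the quotient of two
  of its three distinct roots is a primitive cube root of unity, of degree `2 ∤ 3` over `ℚ`); in
  Installment 2 the second ramified prime `q` played this role.

## References

* T. Honda, *Pure cubic fields whose class numbers are multiples of three*, J. Number Theory 3
  (1971) 7–12, §1. [Honda1971]
* M. Ishida, *The genus fields of algebraic number fields*, Lecture Notes in Math. 555, Springer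
  (1976), Ch. 7, eq. (7.7). [Ishida1976]
* D. A. Marcus, *Number Fields*, 2nd ed. (2018), Ch. 3 (total ramification of `p ∣ m` in `ℚ(∛m)`). [Marcus2018]
-/

noncomputable section

open Polynomial NumberField IsDedekindDomain
open scoped IntermediateField nonZeroDivisors

namespace Literature.NumberTheory.NumberFields

namespace Honda1971

/-! ### The polynomial `X³ − m` for `3 ∤ v_ℓ(m)` -/

/-- If `3 ∤ v_ℓ(m)` for a prime `ℓ` then `m` is not a rational cube: `3 v_ℓ(b) = v_ℓ(m)` is
impossible. [folklore] -/
theorem pow_three_ne_of_not_dvd_padicValNat {ℓ m : ℕ} (hℓ : ℓ.Prime) (hm : ¬ 3 ∣ padicValNat ℓ m)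
    (b : ℚ) : b ^ 3 ≠ (m : ℚ) := by
  intro hb
  haveI : Fact ℓ.Prime := ⟨hℓ⟩
  have hm0 : m ≠ 0 := by
    rintro rfl
    simp at hm
  have h1 : padicValRat ℓ (b ^ 3) = (3 : ℕ) * padicValRat ℓ b := padicValRat.pow b
  have h2 : padicValRat ℓ ((m : ℚ)) = padicValNat ℓ m := padicValRat.of_nat
  rw [hb, h2] at h1
  apply hm
  have h3 : (padicValNat ℓ m : ℤ) = 3 * padicValRat ℓ b := by exact_mod_cast h1
  exact Int.natCast_dvd_natCast.mp ⟨padicValRat ℓ b, h3⟩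

/-- **`X³ − m` is irreducible over `ℚ`** when `3 ∤ v_ℓ(m)` for some prime `ℓ`. [folklore] -/
theorem irreducible_X_pow_three_sub_natCast {ℓ m : ℕ} (hℓ : ℓ.Prime)
    (hm : ¬ 3 ∣ padicValNat ℓ m) : Irreducible (X ^ 3 - C (m : ℚ) : ℚ[X]) :=
  X_pow_sub_C_irreducible_of_prime Nat.prime_three (pow_three_ne_of_not_dvd_padicValNat hℓ hm)

variable {K : Type*} [Field K] [NumberField K]

/-- The minimal polynomial of a cube root of `m` (`3 ∤ v_ℓ(m)`) is `X³ − m`. [folklore] -/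
theorem minpoly_eq_of_not_dvd_padicValNat {ℓ m : ℕ} (hℓ : ℓ.Prime)
    (hm : ¬ 3 ∣ padicValNat ℓ m) {α : K} (hα : α ^ 3 = (m : K)) :
    minpoly ℚ α = X ^ 3 - C (m : ℚ) := by
  refine (minpoly.eq_of_irreducible_of_monic (irreducible_X_pow_three_sub_natCast hℓ hm) ?_
    (monic_X_pow_sub_C _ (by norm_num))).symm
  simp [hα]

/-- A cubic number field containing a cube root `α` of `m` (`3 ∤ v_ℓ(m)`) is `ℚ(α)`. [folklore] -/
theorem adjoin_eq_top_of_not_dvd_padicValNat {ℓ m : ℕ} (hℓ : ℓ.Prime)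
    (hm : ¬ 3 ∣ padicValNat ℓ m) (h3 : Module.finrank ℚ K = 3) {α : K} (hα : α ^ 3 = (m : K)) :
    IntermediateField.adjoin ℚ {α} = ⊤ := by
  rw [Field.primitive_element_iff_minpoly_natDegree_eq, minpoly_eq_of_not_dvd_padicValNat hℓ hm hα,
    h3, natDegree_X_pow_sub_C]

/-! ### `ℓ` is totally ramified in `K` -/

omit [NumberField K] in
/-- A cube root of the natural number `m` is an algebraic integer. [folklore] -/
theorem exists_ringOfIntegers_coe_eq_of_pow_three {m : ℕ} {α : K} (hα : α ^ 3 = (m : K)) :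
    ∃ θ : 𝓞 K, (θ : K) = α := by
  have hint : IsIntegral ℤ α := by
    refine ⟨X ^ 3 - C (m : ℤ), monic_X_pow_sub_C _ (by norm_num), ?_⟩
    simp [hα]
  exact ⟨⟨α, hint⟩, rfl⟩

omit [NumberField K] in
/-- A proper ideal containing the prime `ℓ` misses every natural number prime to `ℓ`. [folklore] -/
theorem natCast_notMem_of_coprime {ℓ n : ℕ} (hcop : Nat.Coprime ℓ n)
    (v : HeightOneSpectrum (𝓞 K)) (hv : (ℓ : 𝓞 K) ∈ v.asIdeal) : (n : 𝓞 K) ∉ v.asIdeal := by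
  intro hnv
  have hcop' : IsCoprime (ℓ : 𝓞 K) (n : 𝓞 K) := by
    have h' : IsCoprime (ℓ : ℤ) (n : ℤ) := Nat.isCoprime_iff_coprime.mpr hcop
    simpa using h'.map (algebraMap ℤ (𝓞 K))
  obtain ⟨a, b, hab⟩ := hcop'
  have h1 : (1 : 𝓞 K) ∈ v.asIdeal := by
    rw [← hab]
    exact v.asIdeal.add_mem (v.asIdeal.mul_mem_left a hv) (v.asIdeal.mul_mem_left b hnv)
  exact v.isPrime.ne_top ((Ideal.eq_top_iff_one _).mpr h1)

/-- **`ℓ` is totally ramified in a cubic field containing `∛m` when `3 ∤ v_ℓ(m)`**: every prime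
`v ∋ ℓ` of `𝓞 K` has `e(v | ℓ) = 3`.  Proof: write `m = ℓ^a · n` with `ℓ ∤ n`; with
`θ = ∛m ∈ 𝓞 K`, `v(θ)³ = v(ℓ)^a v(n) = v(ℓ)^a` gives `3 · v(θ) = a · e(v|ℓ)`, so `3 ∣ e(v|ℓ)`
as `3 ∤ a`, and `e(v|ℓ) ≤ [K : ℚ] = 3`. [folklore] -/
theorem ramificationIdx_eq_three_of_not_dvd_padicValNat {ℓ m : ℕ} (hℓ : ℓ.Prime)
    (hm : ¬ 3 ∣ padicValNat ℓ m) (h3 : Module.finrank ℚ K = 3) {α : K} (hα : α ^ 3 = (m : K))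
    (v : HeightOneSpectrum (𝓞 K)) (hv : (ℓ : 𝓞 K) ∈ v.asIdeal) :
    v.asIdeal.ramificationIdx ℤ = 3 := by
  classical
  haveI := v.isMaximal
  haveI : Fact ℓ.Prime := ⟨hℓ⟩
  have hm0 : m ≠ 0 := by
    rintro rfl
    simp at hm
  -- `m = ℓ^a · n` with `ℓ ∤ n`
  set a : ℕ := padicValNat ℓ m with hadef
  obtain ⟨n, hn⟩ : ℓ ^ a ∣ m := pow_padicValNat_dvd
  have hℓn : ¬ ℓ ∣ n := by
    intro h
    have : ℓ ^ (a + 1) ∣ m := by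
      rw [hn, pow_succ]
      exact Nat.mul_dvd_mul_left _ h
    exact pow_succ_padicValNat_not_dvd hm0 this
  have hcop : Nat.Coprime ℓ n := (Nat.Prime.coprime_iff_not_dvd hℓ).mpr hℓn
  obtain ⟨θ, hθ⟩ := exists_ringOfIntegers_coe_eq_of_pow_three hα
  have hθ3 : θ ^ 3 = (ℓ : 𝓞 K) ^ a * (n : 𝓞 K) := by
    apply RingOfIntegers.coe_injective
    have h := hα
    rw [← hθ, hn] at h
    push_cast at h ⊢
    exact h
  -- `v ∣ ℓℤ`
  set P : Ideal ℤ := Ideal.span {(ℓ : ℤ)} with hPdef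
  have hunder : v.asIdeal.under ℤ = P := under_int_eq_span hℓ v hv
  haveI : v.asIdeal.LiesOver P := ⟨hunder.symm⟩
  haveI : P.IsMaximal := hunder ▸ Ideal.IsMaximal.under ℤ v.asIdeal
  have hP0 : P ≠ ⊥ := by
    rw [hPdef, Ne, Ideal.span_singleton_eq_bot]
    exact_mod_cast hℓ.ne_zero
  have hPmap : P.map (algebraMap ℤ (𝓞 K)) = Ideal.span {(ℓ : 𝓞 K)} := by
    rw [hPdef, Ideal.map_span, Set.image_singleton, map_natCast]
  have hℓ0 : (ℓ : 𝓞 K) ≠ 0 := by exact_mod_cast hℓ.ne_zero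
  have hn0 : (n : 𝓞 K) ≠ 0 := by
    have : n ≠ 0 := by
      rintro rfl
      exact hm0 (by simpa using hn)
    exact_mod_cast this
  have hPmap0 : P.map (algebraMap ℤ (𝓞 K)) ≠ ⊥ := by
    rw [hPmap, Ne, Ideal.span_singleton_eq_bot]
    exact hℓ0
  -- `e(v|ℓ)` is the multiplicity of `v` in `(ℓ)`, i.e. `v(ℓ) = exp(-e)`
  have he : v.asIdeal.ramificationIdx ℤ = multiplicity v.asIdeal (Ideal.span {(ℓ : 𝓞 K)}) := by
    rw [Ideal.IsDedekindDomain.ramificationIdx_eq_multiplicity P v.asIdeal hPmap0, hPmap]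
  have hvℓ : v.intValuation (ℓ : 𝓞 K) = WithZero.exp (-(v.asIdeal.ramificationIdx ℤ : ℤ)) := by
    rw [he]
    exact v.intValuation_eq_exp_neg_multiplicity hℓ0
  -- `v(n) = 1`
  have hvn : v.intValuation (n : 𝓞 K) = 1 :=
    HeightOneSpectrum.intValuation_eq_one_iff.mpr (natCast_notMem_of_coprime hcop v hv)
  -- `v(θ) = exp(-k)`
  have hθ0 : θ ≠ 0 := by
    rintro rfl
    rw [zero_pow (by norm_num)] at hθ3
    exact mul_ne_zero (pow_ne_zero _ hℓ0) hn0 hθ3.symm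
  have hvθ := v.intValuation_eq_exp_neg_multiplicity hθ0
  set k : ℕ := multiplicity v.asIdeal (Ideal.span {θ}) with hkdef
  -- `v(θ)³ = v(ℓ)^a v(n)`
  have hval : WithZero.exp (-(k : ℤ)) ^ 3 =
      WithZero.exp (-(v.asIdeal.ramificationIdx ℤ : ℤ)) ^ a := by
    rw [← hvθ, ← map_pow, hθ3, map_mul, map_pow, hvℓ, hvn, mul_one]
  rw [← WithZero.exp_nsmul, ← WithZero.exp_nsmul, WithZero.exp_inj] at hval
  have h3dvd : (3 : ℤ) * k = a * (v.asIdeal.ramificationIdx ℤ : ℤ) := by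
    rw [nsmul_eq_mul, nsmul_eq_mul] at hval
    push_cast at hval
    linarith
  have h3dvd' : 3 * k = a * v.asIdeal.ramificationIdx ℤ := by exact_mod_cast h3dvd
  -- `0 < e ≤ 3`
  have hle : v.asIdeal.ramificationIdx ℤ ≤ 3 := by
    have h := Ideal.ramificationIdx_le_finrank (S := 𝓞 K) ℚ K v.asIdeal (p := P)
    rwa [Ideal.ramificationIdx'_eq_ramificationIdx P v.asIdeal hP0, h3] at h
  have hpos : 0 < v.asIdeal.ramificationIdx ℤ := Ideal.ramificationIdx_pos v.asIdeal ℤ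
  -- `3 ∣ a · e`, `3 ∤ a`, hence `3 ∣ e`
  have h3e : 3 ∣ v.asIdeal.ramificationIdx ℤ := by
    have h3ae : 3 ∣ a * v.asIdeal.ramificationIdx ℤ := ⟨k, by omega⟩
    rcases (Nat.Prime.dvd_mul Nat.prime_three).mp h3ae with h | h
    · exact absurd h hm
    · exact h
  obtain ⟨c, hc⟩ := h3e
  omega

/-! ### No cube root of `m` in a Galois cubic field -/

/-- **`X³ − m` has no root in a Galois cubic number field** (`m` not a rational cube): the minimal
polynomial `X³ − m` of such a root would split in the normal extension `C/ℚ`, its three distinct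
roots differ by primitive cube roots of unity, and `[ℚ(ζ₃) : ℚ] = 2 ∤ 3 = [C : ℚ]`. [folklore] -/
theorem pow_three_ne_natCast_of_isGalois {E : Type*} [Field E] [NumberField E] [IsGalois ℚ E]
    (hE : Module.finrank ℚ E = 3) {m : ℕ} (hm : ∀ b : ℚ, b ^ 3 ≠ (m : ℚ)) (γ : E) :
    γ ^ 3 ≠ (m : E) := by
  classical
  intro hγ
  have hm0 : (m : E) ≠ 0 := by
    intro h
    have : (m : ℚ) = 0 := by exact_mod_cast (show (m : ℕ) = 0 by exact_mod_cast h)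
    exact hm 0 (by rw [this]; norm_num)
  have hγ0 : γ ≠ 0 := by
    rintro rfl
    exact hm0 (by rw [← hγ]; norm_num)
  -- the minimal polynomial `X³ − m` of `γ` splits in `E`
  have hirr : Irreducible (X ^ 3 - C (m : ℚ) : ℚ[X]) :=
    X_pow_sub_C_irreducible_of_prime Nat.prime_three hm
  have hmin : minpoly ℚ γ = X ^ 3 - Polynomial.C (m : ℚ) := by
    refine (minpoly.eq_of_irreducible_of_monic hirr ?_ (monic_X_pow_sub_C _ (by norm_num))).symm
    simp [hγ]
  have hsplit : ((X ^ 3 - Polynomial.C (m : ℚ) : ℚ[X]).map (algebraMap ℚ E)).Splits :=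
    hmin ▸ Normal.splits inferInstance γ
  have hmapeq : ((X ^ 3 - Polynomial.C (m : ℚ) : ℚ[X]).map (algebraMap ℚ E)) =
      X ^ 3 - Polynomial.C (m : E) := by
    simp [Polynomial.map_sub, Polynomial.map_pow]
  rw [hmapeq] at hsplit
  -- three distinct roots
  have hf0 : (X ^ 3 - Polynomial.C (m : E) : E[X]) ≠ 0 := X_pow_sub_C_ne_zero (by norm_num) _
  have hcard : (X ^ 3 - Polynomial.C (m : E) : E[X]).roots.card = 3 := by
    have h := hsplit.natDegree_eq_card_roots
    rw [natDegree_X_pow_sub_C] at h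
    exact h.symm
  have hsep : (X ^ 3 - Polynomial.C (m : E) : E[X]).Separable :=
    separable_X_pow_sub_C (m : E) (by norm_num) hm0
  have hnodup : (X ^ 3 - Polynomial.C (m : E) : E[X]).roots.Nodup := nodup_roots hsep
  -- a root `γ' ≠ γ`
  obtain ⟨γ', hγ'mem, hne⟩ : ∃ γ' ∈ (X ^ 3 - Polynomial.C (m : E) : E[X]).roots, γ' ≠ γ := by
    by_contra h
    push Not at h
    have hsub : (X ^ 3 - Polynomial.C (m : E) : E[X]).roots.toFinset ⊆ {γ} := fun x hx =>
      Finset.mem_singleton.mpr (h x (Multiset.mem_toFinset.mp hx))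
    have := Finset.card_le_card hsub
    rw [Multiset.toFinset_card_of_nodup hnodup, hcard, Finset.card_singleton] at this
    omega
  have hγ'3 : γ' ^ 3 = (m : E) := by
    rw [mem_roots hf0, IsRoot.def] at hγ'mem
    simpa [sub_eq_zero] using hγ'mem
  -- `ω = γ'/γ` is a primitive cube root of unity
  set ω : E := γ' / γ with hωdef
  have hω3 : ω ^ 3 = 1 := by
    rw [hωdef, div_pow, hγ'3, hγ, div_self hm0]
  have hω1 : ω ≠ 1 := by
    intro h
    rw [hωdef, div_eq_one_iff_eq hγ0] at h
    exact hne h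
  have hω2 : ω ^ 2 ≠ 1 := by
    intro h
    apply hω1
    have : ω ^ 3 = ω * ω ^ 2 := by ring
    rw [this, h, mul_one] at hω3
    exact hω3
  have hprim : IsPrimitiveRoot ω 3 := by
    refine IsPrimitiveRoot.mk_of_lt ω (by norm_num) hω3 ?_
    intro l hl0 hl3
    interval_cases l
    · simpa using hω1
    · exact hω2
  -- `[ℚ(ω) : ℚ] = 2` divides `[E : ℚ] = 3`
  have hint : IsIntegral ℚ ω := .of_finite ℚ ω
  have h2 : Module.finrank ℚ ℚ⟮ω⟯ = 2 := by
    rw [IntermediateField.adjoin.finrank hint, ← cyclotomic_eq_minpoly_rat hprim (by norm_num),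
      natDegree_cyclotomic, Nat.totient_prime Nat.prime_three]
  have htower := Module.finrank_mul_finrank ℚ ℚ⟮ω⟯ E
  rw [h2, hE] at htower
  omega

end Honda1971

end Literature.NumberTheory.NumberFields

end
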